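import Mathlib

/-!
# The two-body sector: Gaussian domination with the free constant for hard-core lattice bosons

Solo line II, door 3, paper §12.7 (Theorem 12.5). For two hard-core bosons on the discrete torus
`(ℤ/L)^d` with the standard hopping Hamiltonian (one-particle dispersion `ω_q = Σᵢ 2(1 - cos qᵢ)`,
`E₁ = 0`), the one-particle zero-frequency susceptibility of the one-particle ground state at total
momentum `P ≠ 0` and spectral parameter `μ` below the two-particle threshold is given by a
Krein (rank-one constraint) formula

  `ω_P · m₋₁(P; μ) = ω_P / (ω_P - μ + 2 / M_P(μ))`,  `M_P(μ) = Σ_{q ∉ {0,P}} 1 / (ω_q + ω_{P-q} - μ)`,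

and the two-particle ground-state energy `δ₂ = E₂(0)` is the smallest root of the secular equation
`1/s = Σ_{q ≠ 0} 1/(2ω_q - s)` (paper Prop. 12.4; operator-theoretic, not formalised here).
Theorem 12.5 of the paper states that the *structural* Gaussian-domination inequality with the free
constant, `ω_P · m₋₁(P; μ) ≤ 1`, holds in this sector for every `d ≥ 1`, `L ≥ 3`, `P ≠ 0` and
`0 < μ ≤ δ₂`, in the sharper form `ω_P · m₋₁(P; μ) ≤ 1 - μ/ω_P`.

Given the Krein formula, the proof is a finite-sum inequality, which is what this file proves in
full generality over an abstract finite index type (`ι` = the momenta `q ∉ {0, P}`, `σ` = the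
involution `q ↦ P - q`, `Ω = ω_P`):

* `inv_pair_energy_le` — AM–HM on one pair: `1/(a + b - μ) ≤ (1/(2a - μ) + 1/(2b - μ))/2`;
* `pair_continuum_sum_le` — summing and reindexing by `σ`:
  `Σ_q 1/(ω_q + ω_{σ q} - μ) ≤ Σ_q 1/(2ω_q - μ)` (the two-particle continuum at total momentum `P`
  is pairwise at least as stiff, in harmonic mean, as the `P = 0` continuum);
* `krein_ratio_le` — the algebra: `0 < μ < Ω`, `0 < M ≤ 1/μ - 1/(2Ω - μ)` imply
  `Ω/(Ω - μ + 2/M) ≤ 1 - μ/Ω`;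
* `twoBody_gaussian_domination` — the combination: if the secular inequality
  `Σ_q 1/(2ω_q - μ) ≤ 1/μ - 1/(2Ω - μ)` holds (for `μ ≤ δ₂` it follows from the secular equation,
  monotonicity in `s`, and splitting off the term `q = P`), then
  `Ω / (Ω - μ + 2 / Σ_q 1/(ω_q + ω_{σ q} - μ)) ≤ 1 - μ/Ω`.

Equality holds in every step for `d = 1`, `L = 4`, `P = π`, `μ = δ₂ = 4 - 2√2`. The inequality is
*not* structural on the class of repulsive interactions: paper Prop. 12.6 gives exact violations for
nearest-neighbour repulsion (the sign is that of the exchange amplitude). No analysis enters.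
-/

namespace Summit.AtomisticToContinuum.BoseEinsteinCondensation.Theorems

open Finset

/-- AM–HM on one pair of the two-particle continuum: for `μ < 2a`, `μ < 2b`,
`1/(a + b - μ) ≤ (1/(2a - μ) + 1/(2b - μ))/2`. -/
theorem inv_pair_energy_le (a b μ : ℝ) (ha : μ < 2 * a) (hb : μ < 2 * b) :
    1 / (a + b - μ) ≤ (1 / (2 * a - μ) + 1 / (2 * b - μ)) / 2 := by
  have ha' : 0 < 2 * a - μ := by linarith
  have hb' : 0 < 2 * b - μ := by linarith
  have hab : 0 < a + b - μ := by linarith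
  have key : (1 / (2 * a - μ) + 1 / (2 * b - μ)) / 2 - 1 / (a + b - μ)
      = (a - b) ^ 2 / ((2 * a - μ) * (2 * b - μ) * (a + b - μ)) := by
    field_simp
    ring
  have hnn : 0 ≤ (a - b) ^ 2 / ((2 * a - μ) * (2 * b - μ) * (a + b - μ)) := by positivity
  linarith [key, hnn]

variable {ι : Type*} [Fintype ι]

/-- **Stiffness of the pair continuum.** For a dispersion `ω` on a finite set of momenta, a
permutation `σ` (the reflection `q ↦ P - q`) and `μ` below the continuum (`μ < 2ω_q` for all `q`):
`Σ_q 1/(ω_q + ω_{σ q} - μ) ≤ Σ_q 1/(2ω_q - μ)`. -/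
theorem pair_continuum_sum_le (ω : ι → ℝ) (σ : Equiv.Perm ι) (μ : ℝ) (hω : ∀ q, μ < 2 * ω q) :
    ∑ q, 1 / (ω q + ω (σ q) - μ) ≤ ∑ q, 1 / (2 * ω q - μ) := by
  have hre : ∑ q, 1 / (2 * ω (σ q) - μ) = ∑ q, 1 / (2 * ω q - μ) :=
    Equiv.sum_comp σ (fun q => 1 / (2 * ω q - μ))
  calc ∑ q, 1 / (ω q + ω (σ q) - μ)
      ≤ ∑ q, (1 / (2 * ω q - μ) + 1 / (2 * ω (σ q) - μ)) / 2 :=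
        Finset.sum_le_sum fun q _ => inv_pair_energy_le (ω q) (ω (σ q)) μ (hω q) (hω (σ q))
    _ = (∑ q, 1 / (2 * ω q - μ) + ∑ q, 1 / (2 * ω (σ q) - μ)) / 2 := by
        rw [← Finset.sum_add_distrib, Finset.sum_div]
    _ = ∑ q, 1 / (2 * ω q - μ) := by rw [hre]; ring

/-- **The algebra of the Krein ratio.** If `0 < μ < Ω` and `0 < M ≤ 1/μ - 1/(2Ω - μ)` then
`Ω / (Ω - μ + 2/M) ≤ 1 - μ/Ω`. -/
theorem krein_ratio_le (μ Ω M : ℝ) (hμ : 0 < μ) (hΩ : μ < Ω) (hM : 0 < M)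
    (hsec : M ≤ 1 / μ - 1 / (2 * Ω - μ)) :
    Ω / (Ω - μ + 2 / M) ≤ 1 - μ / Ω := by
  have hΩ0 : 0 < Ω := lt_trans hμ hΩ
  have h2 : 0 < 2 * Ω - μ := by linarith
  have hΩμ : 0 < Ω - μ := by linarith
  -- the secular inequality in polynomial form: `M μ (2Ω - μ) ≤ 2 (Ω - μ)`
  have e : 1 / μ - 1 / (2 * Ω - μ) = 2 * (Ω - μ) / (μ * (2 * Ω - μ)) := by
    field_simp
    ring
  have h1 : M * (μ * (2 * Ω - μ)) ≤ 2 * (Ω - μ) := by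
    rw [e, le_div_iff₀ (by positivity)] at hsec
    exact hsec
  -- hence `(Ω - μ) · (2/M) ≥ μ (2Ω - μ)` and `(Ω - μ)(Ω - μ + 2/M) ≥ Ω²`
  have key : μ * (2 * Ω - μ) ≤ (Ω - μ) * (2 / M) := by
    rw [mul_div_assoc', le_div_iff₀ hM]
    linarith [h1]
  have hD : 0 < Ω - μ + 2 / M := by positivity
  calc Ω / (Ω - μ + 2 / M) ≤ (Ω - μ) / Ω := by
        rw [div_le_div_iff₀ hD hΩ0]
        nlinarith [key]
    _ = 1 - μ / Ω := by field_simp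

/-- **Two-body Gaussian domination with the free constant (paper Theorem 12.5, finite-sum core).**
For a dispersion `ω` on a nonempty finite momentum set (the momenta `q ∉ {0,P}`), the reflection
`σ : q ↦ P - q`, the mode energy `Ω = ω_P` and a spectral parameter `0 < μ < Ω` below the continuum
satisfying the secular inequality `Σ_q 1/(2ω_q - μ) ≤ 1/μ - 1/(2Ω - μ)` (valid for `μ ≤ δ₂`), the
Krein ratio obeys `Ω / (Ω - μ + 2/M) ≤ 1 - μ/Ω` with `M = Σ_q 1/(ω_q + ω_{σ q} - μ)`; by the Krein
formula the left-hand side is `ω_P · m₋₁(P; μ)`, the two-body value of `ε_k · χ_k(μ)`. -/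
theorem twoBody_gaussian_domination [Nonempty ι] (ω : ι → ℝ) (σ : Equiv.Perm ι) (μ Ω : ℝ)
    (hμ : 0 < μ) (hΩ : μ < Ω) (hω : ∀ q, μ < 2 * ω q)
    (hsec : ∑ q, 1 / (2 * ω q - μ) ≤ 1 / μ - 1 / (2 * Ω - μ)) :
    Ω / (Ω - μ + 2 / ∑ q, 1 / (ω q + ω (σ q) - μ)) ≤ 1 - μ / Ω := by
  have hMpos : 0 < ∑ q, 1 / (ω q + ω (σ q) - μ) := by
    apply Finset.sum_pos
    · intro q _
      have := hω q
      have := hω (σ q)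
      have : 0 < ω q + ω (σ q) - μ := by linarith
      positivity
    · exact Finset.univ_nonempty
  exact krein_ratio_le μ Ω _ hμ hΩ hMpos ((pair_continuum_sum_le ω σ μ hω).trans hsec)

end Summit.AtomisticToContinuum.BoseEinsteinCondensation.Theorems
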